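import Summits.QuantumFields.BalabanUV.T4Continuum.Support.ShellMeasureScalingLocal
import Literature.MathematicalPhysics.QuantumFieldTheory.Balaban1983to89.T4AveragingDisintegration
import Mathlib.Probability.Kernel.Composition.MeasureComp

/-!
# `T4Continuum.ShellMeasureSuperposition` — (M1) AND THE ENGINE'S LOCATED INPUTS ARE PRESERVED UNDER POSITIVE
# SUPERPOSITION (countable sums, kernel mixtures `κ ∘ₘ π`, density mixtures `x ↦ ∫⁻ g t x ∂π`, the cell's
# disintegration `ν = condLaw ν Q ∘ₘ ν.map Q`)
(cell `pub-balaban`, sub-cell `t4`, spine estimate NE7c (node U5b); NE7c ROUND-2 crew `t4-ne7c-formalise-*`, seat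
`b2b-balaban-t4-ne7c-formalise-leaf-03` (gen 3); an idle-seat OFFER (journal `CLAIMS.log` l.12746) = the KERNEL HALF of
the owner's pricing remark N-ne7cp1-g27-1 (`t4/b2b-balaban-t4-ne7c-p1/WALL-NE7c-P1.md` §4 (N): «the alternative cut
would trade W-e for W-b on the 𝐑-dressed density (ray-weight loss is preserved under positive superposition)»);
ADDITIVE — imports the engine `ShellMeasureScalingLocal` (p200140), the cell's disintegration vocabulary
`T4AveragingDisintegration` (Literature, [folklore] §1) and Mathlib's `Probability.Kernel.Composition.MeasureComp`
only, modifies nothing; 0 `def`, 0 sorry, 0 cite)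

HONEST FRAMING.  Finite four-torus programme, rung (B)+1 only — NOT infinite volume, NOT a mass gap, NOT the Clay
problem, NOT summit progress; (B), `BetaPertHyp`, (B^μ) are not consumed.  (M1) for Bałaban's inductively defined
effective measures is NOT PRINTED (GAPS G-ne7cp1-1), asserted by nobody, NOT moved here.  NE7c ⇐ the named binders
(trigger c3); NE7c NOT PRINTED, NOT proved; spine PROVED 0/9 before and after.  STRUCTURAL BOOKKEEPING — [folklore]
measure theory (monotonicity of the integral, Tonelli, the Giry bind, Mathlib's `Measure.snd_compProd`); no estimate,
no `def` (c2), no citation; NOTHING of Bałaban's (no term family, no 𝐑 operation, no block weight) is instantiated.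
HONEST DEPENDENCY (cell, verbatim): continuum YM on T⁴ ⇐ BetaPertH ∧ nine spine estimates (0/9 proved); BetaPertH ⇐
(D1) ∧ (D4) ∧ CAP+tail; G-an2-4 gates asym, D1 and NE2/3/4.

THE POINT.  (M1) = `T4ShellMeasure.SlotAntiConcentration μ u θ ρ D` («`μ{θ(1−ρ) ≤ u < θ} ≤ D·ρ·μ(univ)`») is LINEAR
in the measure `μ`: it holds for any POSITIVE SUPERPOSITION of measures for which it holds with the SAME `θ ρ D`.  The
tree has the finite-sum form (S24 `ShellMeasureRootCompositionHistories.slotAntiConcentration_finsetSum` — «the route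
from (M1) PER HISTORY to (M1) for a partial law») and the scalar form (`ShellMeasureWilsonLedgerSource.
slotAntiConcentration_smul`); NOT re-stated here — and the END-I of record's per-slot binder `hacA`∕`hacB` is (M1)
for the `s`-small PARTIAL LAW, a FINITE sum over histories in S24's typing, so under the cut of record the finite form
is all END-I consumes.  THIS FILE supplies the integral forms — needed only where a slot law is READ as a continuous
superposition: an 𝐑-dressed density under the alternative cut of N-ne7cp1-g27-1 (the 𝐑 operation of
[Balaban1989LargeFieldI]/[Balaban1989LargeFieldII] INTEGRATES OUT large-field variables, `∫ (weight given Z) dZ` —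
TYPE only, nothing of it is constructed here, and whether a history's law IS such an integral is the [dict] seat's to
say), or the fibre reading of (LR)_j through the cell's `condLaw` (§4) — and the ENGINE-LEVEL form the owner's
parenthesis names:
* §1 MEASURES: `slotAntiConcentration_sum` (countable `Measure.sum`), `slotAntiConcentration_bind` ((M1) for the Giry
  mixture `m.bind f` ⇐ (M1) for `f a`, `m`-a.e. `a`), `slotAntiConcentration_comp` (kernel form `κ ∘ₘ π`),
  `slotAntiConcentration_compProd` ((M1) for `π ⊗ₘ κ` along a jointly measurable `u` ⇐ (M1) for `κ a` along
  `u (a, ·)`, `π`-a.e. — the KERNEL form of `T4ShellMeasureLocal.slotAntiConcentration_of_sections`' «exterior ×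
  block» bookkeeping, exterior law and block kernel arbitrary s-finite).
* §2 DENSITIES: `withDensity_lintegral_apply` (Tonelli: `(μ.withDensity (x ↦ ∫⁻ g t x ∂π)) S = ∫⁻ t,
  (μ.withDensity (g t)) S ∂π`), `slotAntiConcentration_withDensity_lintegral` ((M1) for the mixture density ⇐ (M1)
  for `π`-a.e. member density, SAME constants).
* §3 THE ENGINE'S LOCATED INPUTS (GAPS G-ne7cp1-21: (S-i) core map, (S-ii) ray-weight loss, ONE contraction depth
  `a`): `rayLoss_lintegral` — (S-ii) `f x ≤ e^{B_f a}·f(e^{−a}x)` for the mixture `f = ∫⁻ g t · ∂π` ⇐ (S-ii) for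
  every member with the SAME `a`, `B_f` (the owner's «ray-weight loss is preserved under positive superposition»);
  `exists_ne_zero_of_lintegral_ne_zero` — where the mixture charges, some member charges, so (S-i) for the members
  IS (S-i) for the mixture; **`slotAntiConcentration_of_coreMap_mul_lintegral`** — the engine
  `ShellMeasureScalingLocal.slotAntiConcentration_of_coreMap_mul` FIRED on the density `J · ∫⁻ g t · ∂π` with a
  COMMON centre-monotone co-factor `J` (`J x ≤ J(e^{−a}x)`: kept co-tests, a star-shaped window, a chart Jacobian
  maximal at the centre — N-ne7cp1-g27-1's «the two outcomes carry the SAME co-factor in every term») riding free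
  and (S-i)/(S-ii) asked of the MEMBERS `g t` only: conclusion (M1) with `D`, `(dim E + B_f)·a ≤ D·ρ`, and NO mass
  ratio — under a cut for which the slot's realized law IS such a superposition the (MR)_j binder (WALL §2 (k), W-e;
  S22 `hac_dominatedLevelData` ∕ S38 `hmassX`) is not needed, the displayed input being (S-ii) PER MEMBER (W-b TYPE).
* §4 THE CELL'S DISINTEGRATION: `eq_condLaw_comp_map` (`ν = condLaw ν Q ∘ₘ ν.map Q` for a finite `ν` on a standard
  Borel space and a measurable `Q` — `T4AveragingDisintegration.fst_compProd_condLaw` + `jointLaw_fst/snd` +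
  `Measure.snd_compProd`), **`slotAntiConcentration_of_condLaw`** ((M1) for `ν` ⇐ (M1) for `(ν.map Q)`-a.e. fibre
  law `condLaw ν Q b`, SAME constants) — the socket this seat's S37 `ShellMeasureLinearizedCondLaw.condLaw_ae_eq_
  fibreLaw` (the explicit curved-chart fibre laws ARE `condLaw` a.e.) plugs into.
WHAT THIS DOES NOT DO.  It does not say that any of Bałaban's slot laws IS such a superposition with member-wise
(S-i)/(S-ii) — that is the CUT's content (W-b/W-c TYPE, displayed, N-ne7cp1-g27-1: «the alternative cut would trade
W-e for W-b on the 𝐑-dressed density»); under the cell's cut of record (`T4RecentScale`; S24's partial laws + S22's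
level-indexed (MR)_j) nothing changes.  No instance of SM-L1/L3/L4/L6 at any `j ≥ 1`; (M1) per live slot stays THE
wall; NOTHING in the countdown moves.
-/

noncomputable section

open Set Function MeasureTheory MeasureTheory.Measure ProbabilityTheory
open scoped ENNReal ProbabilityTheory

namespace Summit.QuantumFields.BalabanUV.T4Continuum.ShellMeasureSuperposition

open Literature.MathematicalPhysics.QuantumFieldTheory.Balaban1983to89
open T4ShellMeasure (SlotAntiConcentration)

/-! ## §0 The shell event is measurable for a measurable tested variable -/

section Shell

variable {Ω : Type*} [MeasurableSpace Ω]

/-- the shell `{θ(1−ρ) ≤ u < θ}` of a measurable tested variable is a measurable set. [folklore] -/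
theorem measurableSet_shell {u : Ω → ℝ} (hu : Measurable u) (θ ρ : ℝ) :
    MeasurableSet {x | θ * (1 - ρ) ≤ u x ∧ u x < θ} := by
  rw [T4ShellMeasure.shell_eq_preimage]
  exact hu measurableSet_Ico

end Shell

/-! ## §1 (M1) under positive superposition of MEASURES: countable sums, Giry mixtures, kernels -/

section Measures

variable {Ω : Type*} [MeasurableSpace Ω]

/-- **(M1) FOR A COUNTABLE SUM OF MEASURES** ⇐ (M1) for every summand, SAME `θ ρ D` (no measurability needed:
`Measure.sum_apply_of_countable`).  The finite-sum form is S24's `slotAntiConcentration_finsetSum`. [folklore] -/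
theorem slotAntiConcentration_sum {ι : Type*} [Countable ι] (μ : ι → Measure Ω) {u : Ω → ℝ} {θ ρ D : ℝ}
    (h : ∀ i, SlotAntiConcentration (μ i) u θ ρ D) : SlotAntiConcentration (Measure.sum μ) u θ ρ D := by
  unfold T4ShellMeasure.SlotAntiConcentration at h ⊢
  rw [Measure.sum_apply_of_countable, Measure.sum_apply_of_countable, ← ENNReal.tsum_mul_left]
  exact ENNReal.tsum_le_tsum h

/-- **(M1) FOR A GIRY MIXTURE** `m.bind f` (the measure `S ↦ ∫⁻ a, f a S ∂m`) ⇐ (M1) for `f a`, `m`-almost every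
`a`, SAME `θ ρ D`; `u` measurable, `f` a.e.-measurable as a measure-valued map. [folklore] -/
theorem slotAntiConcentration_bind {α : Type*} [MeasurableSpace α] {m : Measure α} {f : α → Measure Ω}
    (hf : AEMeasurable f m) {u : Ω → ℝ} (hu : Measurable u) {θ ρ D : ℝ}
    (h : ∀ᵐ a ∂m, SlotAntiConcentration (f a) u θ ρ D) : SlotAntiConcentration (m.bind f) u θ ρ D := by
  unfold T4ShellMeasure.SlotAntiConcentration at h ⊢
  have hS := measurableSet_shell hu θ ρ
  rw [Measure.bind_apply hS hf, Measure.bind_apply MeasurableSet.univ hf,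
    ← lintegral_const_mul' _ _ ENNReal.ofReal_ne_top]
  exact lintegral_mono_ae h

/-- **(M1) FOR A KERNEL MIXTURE** `κ ∘ₘ π` ⇐ (M1) for `κ a`, `π`-almost every `a`, SAME `θ ρ D`. [folklore] -/
theorem slotAntiConcentration_comp {α : Type*} [MeasurableSpace α] (κ : Kernel α Ω) (π : Measure α)
    {u : Ω → ℝ} (hu : Measurable u) {θ ρ D : ℝ} (h : ∀ᵐ a ∂π, SlotAntiConcentration (κ a) u θ ρ D) :
    SlotAntiConcentration (κ ∘ₘ π) u θ ρ D :=
  slotAntiConcentration_bind κ.aemeasurable hu h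

/-- **(M1) FOR A COMPOSITION-PRODUCT** `π ⊗ₘ κ` («exterior law ⊗ block kernel») along a jointly measurable tested
variable `u` ⇐ (M1) for the SECTION `κ a` along `u (a, ·)`, `π`-almost every exterior `a`, SAME `θ ρ D` — the kernel
form of `T4ShellMeasureLocal.slotAntiConcentration_of_sections`. [folklore] -/
theorem slotAntiConcentration_compProd {α : Type*} [MeasurableSpace α] (π : Measure α) [SFinite π]
    (κ : Kernel α Ω) [IsSFiniteKernel κ] {u : α × Ω → ℝ} (hu : Measurable u) {θ ρ D : ℝ}
    (h : ∀ᵐ a ∂π, SlotAntiConcentration (κ a) (fun x => u (a, x)) θ ρ D) :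
    SlotAntiConcentration (π ⊗ₘ κ) u θ ρ D := by
  unfold T4ShellMeasure.SlotAntiConcentration at h ⊢
  have hS := measurableSet_shell hu θ ρ
  rw [Measure.compProd_apply hS, Measure.compProd_apply MeasurableSet.univ,
    ← lintegral_const_mul' _ _ ENNReal.ofReal_ne_top]
  refine lintegral_mono_ae ?_
  filter_upwards [h] with a ha
  simpa only [preimage_setOf_eq, preimage_univ] using ha

/-- a composition-product with a density, evaluated: `((π ⊗ₘ κ).withDensity G) S = ∫⁻ a, ((κ a).withDensity
(G (a, ·))) (Prod.mk a ⁻¹' S) ∂π` (the sections of the density against the sections of the kernel). [folklore] -/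
theorem compProd_withDensity_apply {α : Type*} [MeasurableSpace α] (π : Measure α) [SFinite π]
    (κ : Kernel α Ω) [IsSFiniteKernel κ] {G : α × Ω → ℝ≥0∞} (hG : Measurable G) {S : Set (α × Ω)}
    (hS : MeasurableSet S) :
    ((π ⊗ₘ κ).withDensity G) S = ∫⁻ a, ((κ a).withDensity fun x => G (a, x)) (Prod.mk a ⁻¹' S) ∂π := by
  rw [withDensity_apply _ hS, ← lintegral_indicator hS, Measure.lintegral_compProd (hG.indicator hS)]
  refine lintegral_congr fun a => ?_
  rw [withDensity_apply _ (measurable_prodMk_left hS), ← lintegral_indicator (measurable_prodMk_left hS)]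
  rfl

/-- **(M1) FOR A REALIZED SLOT LAW IN KERNEL FORM** `(π ⊗ₘ κ).withDensity G` («(exterior law ⊗ block kernel) ·
density») along a jointly measurable `u` ⇐ (M1) for the SECTION `(κ a).withDensity (G (a, ·))` along `u (a, ·)`,
`π`-almost every exterior `a`, SAME `θ ρ D` — `T4ShellMeasureLocal.slotAntiConcentration_of_sections` with the product
reference `ζ.prod μ` replaced by any s-finite composition-product. [folklore] -/
theorem slotAntiConcentration_compProd_withDensity {α : Type*} [MeasurableSpace α] (π : Measure α) [SFinite π]
    (κ : Kernel α Ω) [IsSFiniteKernel κ] {G : α × Ω → ℝ≥0∞} (hG : Measurable G) {u : α × Ω → ℝ}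
    (hu : Measurable u) {θ ρ D : ℝ}
    (h : ∀ᵐ a ∂π, SlotAntiConcentration ((κ a).withDensity fun x => G (a, x)) (fun x => u (a, x)) θ ρ D) :
    SlotAntiConcentration ((π ⊗ₘ κ).withDensity G) u θ ρ D := by
  unfold T4ShellMeasure.SlotAntiConcentration at h ⊢
  have hS := measurableSet_shell hu θ ρ
  rw [compProd_withDensity_apply π κ hG hS, compProd_withDensity_apply π κ hG MeasurableSet.univ,
    ← lintegral_const_mul' _ _ ENNReal.ofReal_ne_top]
  refine lintegral_mono_ae ?_
  filter_upwards [h] with a ha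
  simpa only [preimage_setOf_eq, preimage_univ] using ha

end Measures

/-! ## §2 (M1) under positive superposition of DENSITIES -/

section Densities

variable {Ω τ : Type*} [MeasurableSpace Ω] [MeasurableSpace τ]

/-- TONELLI for a mixture density: `(μ.withDensity (x ↦ ∫⁻ g t x ∂π)) S = ∫⁻ t, (μ.withDensity (g t)) S ∂π` for a
jointly measurable `g` and a measurable `S`. [folklore] -/
theorem withDensity_lintegral_apply (μ : Measure Ω) [SFinite μ] (π : Measure τ) [SFinite π]
    {g : τ → Ω → ℝ≥0∞} (hg : Measurable (uncurry g)) {S : Set Ω} (hS : MeasurableSet S) :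
    (μ.withDensity fun x => ∫⁻ t, g t x ∂π) S = ∫⁻ t, (μ.withDensity (g t)) S ∂π := by
  rw [withDensity_apply _ hS]
  have hsw : AEMeasurable (uncurry fun (x : Ω) (t : τ) => g t x) ((μ.restrict S).prod π) :=
    (hg.comp measurable_swap).aemeasurable
  rw [lintegral_lintegral_swap hsw]
  refine lintegral_congr fun t => ?_
  rw [withDensity_apply _ hS]

/-- **(M1) FOR A MIXTURE DENSITY** `x ↦ ∫⁻ g t x ∂π` ⇐ (M1) for the member density `g t`, `π`-almost every `t`, SAME
`θ ρ D` (`μ`, `π` s-finite, `g` jointly measurable, `u` measurable). [folklore] -/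
theorem slotAntiConcentration_withDensity_lintegral (μ : Measure Ω) [SFinite μ] (π : Measure τ) [SFinite π]
    {g : τ → Ω → ℝ≥0∞} (hg : Measurable (uncurry g)) {u : Ω → ℝ} (hu : Measurable u) {θ ρ D : ℝ}
    (h : ∀ᵐ t ∂π, SlotAntiConcentration (μ.withDensity (g t)) u θ ρ D) :
    SlotAntiConcentration (μ.withDensity fun x => ∫⁻ t, g t x ∂π) u θ ρ D := by
  unfold T4ShellMeasure.SlotAntiConcentration at h ⊢
  have hS := measurableSet_shell hu θ ρ
  rw [withDensity_lintegral_apply μ π hg hS, withDensity_lintegral_apply μ π hg MeasurableSet.univ,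
    ← lintegral_const_mul' _ _ ENNReal.ofReal_ne_top]
  exact lintegral_mono_ae h

/-- **(M1) FOR A COUNTABLE SUM OF DENSITIES** `∑' i, f i` ⇐ (M1) for every `μ.withDensity (f i)`, SAME `θ ρ D`
(`withDensity_tsum` + §1). [folklore] -/
theorem slotAntiConcentration_withDensity_tsum {ι : Type*} [Countable ι] (μ : Measure Ω) {f : ι → Ω → ℝ≥0∞}
    (hf : ∀ i, Measurable (f i)) {u : Ω → ℝ} {θ ρ D : ℝ}
    (h : ∀ i, SlotAntiConcentration (μ.withDensity (f i)) u θ ρ D) :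
    SlotAntiConcentration (μ.withDensity (∑' i, f i)) u θ ρ D := by
  rw [withDensity_tsum hf]
  exact slotAntiConcentration_sum _ h

end Densities

/-! ## §3 The engine's located inputs under superposition: (S-i) core map, (S-ii) ray-weight loss -/

section Engine

variable {E τ : Type*} [NormedAddCommGroup E] [NormedSpace ℝ E] [MeasurableSpace E] [BorelSpace E]
  [FiniteDimensional ℝ E] [MeasurableSpace τ]

omit [NormedAddCommGroup E] [NormedSpace ℝ E] [MeasurableSpace E] [BorelSpace E] [FiniteDimensional ℝ E] in
/-- where a mixture density charges a point, some member does. [folklore] -/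
theorem exists_ne_zero_of_lintegral_ne_zero (π : Measure τ) {g : τ → E → ℝ≥0∞} {x : E}
    (hx : ∫⁻ t, g t x ∂π ≠ 0) : ∃ t, g t x ≠ 0 := by
  by_contra hcon
  have h0 : (fun t => g t x) = fun _ => 0 := funext fun t => not_ne_iff.mp fun h => hcon ⟨t, h⟩
  rw [h0, lintegral_zero] at hx
  exact hx rfl

omit [MeasurableSpace E] [BorelSpace E] [FiniteDimensional ℝ E] in
/-- **(S-ii) RAY-WEIGHT LOSS IS PRESERVED UNDER POSITIVE SUPERPOSITION** (the owner's parenthesis in N-ne7cp1-g27-1):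
if every member satisfies `g t x ≤ e^{B_f a}·g t (e^{−a}x)` wherever it charges `x`, the mixture `∫⁻ g t · ∂π`
satisfies the same inequality at `x`, SAME depth `a`, SAME constant `B_f`. [folklore] -/
theorem rayLoss_lintegral (π : Measure τ) {g : τ → E → ℝ≥0∞} {a Bf : ℝ} {x : E}
    (h : ∀ t, g t x ≠ 0 → g t x ≤ ENNReal.ofReal (Real.exp (Bf * a)) * g t (Real.exp (-a) • x)) :
    ∫⁻ t, g t x ∂π ≤ ENNReal.ofReal (Real.exp (Bf * a)) * ∫⁻ t, g t (Real.exp (-a) • x) ∂π := by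
  rw [← lintegral_const_mul' _ _ ENNReal.ofReal_ne_top]
  refine lintegral_mono fun t => ?_
  by_cases ht : g t x = 0
  · rw [ht]; exact bot_le
  · exact h t ht

omit [MeasurableSpace E] [BorelSpace E] [FiniteDimensional ℝ E] [MeasurableSpace τ] in
/-- the countable-sum form of `rayLoss_lintegral`: (S-ii) for `∑' i, g i` ⇐ (S-ii) for every member, SAME `a`, `B_f`.
[folklore] -/
theorem rayLoss_tsum {ι : Type*} {g : ι → E → ℝ≥0∞} {a Bf : ℝ} {x : E}
    (h : ∀ i, g i x ≠ 0 → g i x ≤ ENNReal.ofReal (Real.exp (Bf * a)) * g i (Real.exp (-a) • x)) :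
    ∑' i, g i x ≤ ENNReal.ofReal (Real.exp (Bf * a)) * ∑' i, g i (Real.exp (-a) • x) := by
  rw [← ENNReal.tsum_mul_left]
  refine ENNReal.tsum_le_tsum fun i => ?_
  by_cases hi : g i x = 0
  · rw [hi]; exact bot_le
  · exact h i hi

omit [MeasurableSpace E] [BorelSpace E] [FiniteDimensional ℝ E] in
/-- (S-i) for the members is (S-i) for the mixture: if the mixture charges a sub-threshold point, a member charges it,
and that member's core map applies. [folklore] -/
theorem coreMap_lintegral (π : Measure τ) {g : τ → E → ℝ≥0∞} {u : E → ℝ} {θ ρ a : ℝ} {x : E}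
    (hcore : ∀ t, u x < θ → g t x ≠ 0 → u (Real.exp (-a) • x) < θ * (1 - ρ))
    (hx : u x < θ) (hne : ∫⁻ t, g t x ∂π ≠ 0) : u (Real.exp (-a) • x) < θ * (1 - ρ) := by
  obtain ⟨t, ht⟩ := exists_ne_zero_of_lintegral_ne_zero π hne
  exact hcore t hx ht

variable (μ : Measure E) [μ.IsAddHaarMeasure]

/-- **(M1) FOR A SUPERPOSED BLOCK WEIGHT WITH A COMMON CO-FACTOR — THE ENGINE FIRED ON THE MIXTURE.**  Density
`J · ∫⁻ g t · ∂π` on a finite-dimensional real space with additive Haar measure `μ`: `J` a COMMON factor that does not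
decrease towards the centre along the contraction (`J x ≤ J(e^{−a}x)`), the members `g t` satisfying (S-i) (core map)
and (S-ii) (ray-weight loss, constant `B_f`) at ONE depth `a` wherever they charge a sub-threshold point; finite
sub-threshold mass of the mixture; `(dim E + B_f)·a ≤ D·ρ`.  CONCLUSION: (M1) `SlotAntiConcentration` for the mixture
with constant `D` — `ShellMeasureScalingLocal.slotAntiConcentration_of_coreMap_mul` BY NAME, its two hypotheses
supplied by `coreMap_lintegral` ∕ `rayLoss_lintegral`.  NO mass ratio appears. [folklore] -/
theorem slotAntiConcentration_of_coreMap_mul_lintegral (π : Measure τ) {J : E → ℝ≥0∞} {g : τ → E → ℝ≥0∞}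
    {u : E → ℝ} (hu : Measurable u) {θ ρ a Bf D : ℝ} (hθ : 0 ≤ θ) (hρ : 0 ≤ ρ)
    (hfin : (μ.withDensity fun x => J x * ∫⁻ t, g t x ∂π) {x | u x < θ} ≠ ∞)
    (hJ : ∀ x, J x ≤ J (Real.exp (-a) • x))
    (hcore : ∀ t x, u x < θ → J x ≠ 0 → g t x ≠ 0 → u (Real.exp (-a) • x) < θ * (1 - ρ))
    (hden : ∀ t x, u x < θ → J x ≠ 0 → g t x ≠ 0 →
      g t x ≤ ENNReal.ofReal (Real.exp (Bf * a)) * g t (Real.exp (-a) • x))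
    (haD : (Module.finrank ℝ E + Bf) * a ≤ D * ρ) :
    SlotAntiConcentration (μ.withDensity fun x => J x * ∫⁻ t, g t x ∂π) u θ ρ D := by
  refine ShellMeasureScalingLocal.slotAntiConcentration_of_coreMap_mul μ hu hθ hρ hfin hJ
    (fun x hx hJx hgx => ?_) (fun x hx hJx _ => ?_) haD
  · exact coreMap_lintegral π (fun t hx' ht => hcore t x hx' hJx ht) hx hgx
  · exact rayLoss_lintegral π fun t ht => hden t x hx hJx ht

/-- The same without a co-factor (`J ≡ 1`): (M1) for the mixture density `∫⁻ g t · ∂π` from member-wise (S-i)/(S-ii)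
— `ShellMeasureScalingLocal.slotAntiConcentration_of_coreMap` on the mixture. [folklore] -/
theorem slotAntiConcentration_of_coreMap_lintegral (π : Measure τ) {g : τ → E → ℝ≥0∞}
    {u : E → ℝ} (hu : Measurable u) {θ ρ a Bf D : ℝ} (hθ : 0 ≤ θ) (hρ : 0 ≤ ρ)
    (hfin : (μ.withDensity fun x => ∫⁻ t, g t x ∂π) {x | u x < θ} ≠ ∞)
    (hcore : ∀ t x, u x < θ → g t x ≠ 0 → u (Real.exp (-a) • x) < θ * (1 - ρ))
    (hden : ∀ t x, u x < θ → g t x ≠ 0 → g t x ≤ ENNReal.ofReal (Real.exp (Bf * a)) * g t (Real.exp (-a) • x))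
    (haD : (Module.finrank ℝ E + Bf) * a ≤ D * ρ) :
    SlotAntiConcentration (μ.withDensity fun x => ∫⁻ t, g t x ∂π) u θ ρ D :=
  ShellMeasureScalingLocal.slotAntiConcentration_of_coreMap μ hu hθ hρ hfin
    (fun x hx hne => coreMap_lintegral π (fun t hx' ht => hcore t x hx' ht) hx hne)
    (fun x hx _ => rayLoss_lintegral π fun t ht => hden t x hx ht) haD

end Engine

/-! ## §4 The cell's disintegration: (M1) for a block law from (M1) for its `condLaw` fibre laws -/

section CondLaw

variable {α β : Type*} [MeasurableSpace α] [MeasurableSpace β] [StandardBorelSpace β] [Nonempty β]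

/-- THE CELL'S DISINTEGRATION AS A KERNEL MIXTURE: a finite law `ν` on a standard Borel space is the mixture of its
conditional kernel `T4AveragingDisintegration.condLaw ν Q` over the law `ν.map Q` of a measurable average `Q`:
`ν = condLaw ν Q ∘ₘ ν.map Q` (`fst_compProd_condLaw` + `jointLaw_fst` ∕ `jointLaw_snd` + `Measure.snd_compProd`).
[folklore] -/
theorem eq_condLaw_comp_map (ν : Measure β) [IsFiniteMeasure ν] {Q : β → α} (hQ : Measurable Q) :
    ν = T4AveragingDisintegration.condLaw ν Q ∘ₘ ν.map Q := by
  have h := T4AveragingDisintegration.fst_compProd_condLaw ν Q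
  rw [T4AveragingDisintegration.jointLaw_fst ν hQ] at h
  have h2 := congrArg Measure.snd h
  rw [Measure.snd_compProd, T4AveragingDisintegration.jointLaw_snd ν hQ] at h2
  exact h2.symm

/-- **(M1) FOR A BLOCK LAW FROM (M1) FOR ITS FIBRE LAWS**: for a finite law `ν` on a standard Borel space, a
measurable average `Q` and a measurable tested variable `u`, if `(ν.map Q)`-almost every conditional law
`condLaw ν Q b` is `(θ, ρ, D)`-anti-concentrated along `u`, so is `ν` — SAME constants.  (With S37
`ShellMeasureLinearizedCondLaw.condLaw_ae_eq_fibreLaw` the hypothesis is (M1) for the explicit normalised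
curved-chart fibre laws, a.e.) [folklore] -/
theorem slotAntiConcentration_of_condLaw (ν : Measure β) [IsFiniteMeasure ν] {Q : β → α} (hQ : Measurable Q)
    {u : β → ℝ} (hu : Measurable u) {θ ρ D : ℝ}
    (h : ∀ᵐ b ∂(ν.map Q), SlotAntiConcentration (T4AveragingDisintegration.condLaw ν Q b) u θ ρ D) :
    SlotAntiConcentration ν u θ ρ D := by
  rw [eq_condLaw_comp_map ν hQ]
  exact slotAntiConcentration_comp _ _ hu h

end CondLaw

end Summit.QuantumFields.BalabanUV.T4Continuum.ShellMeasureSuperposition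

end
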